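import Literature.AlgebraicGeometry.Motives.AbelianVarietyGoodReductionFrobenius
import Literature.AlgebraicGeometry.Motives.AbelianVarietyTateModuleTraceDimensionFormula
import Literature.NumberTheory.GaloisRepresentations.IntegralGaloisActionProofs
import Literature.NumberTheory.Automorphic.Liu2021.AppendixC.EtaleH1LevelSemisimple
import Literature.RepresentationTheory.IntertwiningMapBaseChange
import HarnessLib

/-!
# [Liu 2021, Cor. D.9] on the Albanese tower — the `ℓ`-adic TRANSPORT (road 2′, letter L4): from an Eichler–Shimura identity
# in `End(Ā_K)` at a place of good reduction to `q • Φ_σ² T₂ − Φ_σ T₁ + 1 = 0` on the `K`-fixed classes of `ℚ̄_ℓ ⊗ H¹_ét(A_∞)`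

Topic `NumberTheory/Automorphic/Liu2021/AppendixC`.  THEOREMS ONLY (no definition, no named fact, no instance, no `sorry`).
Cell `hodgecm-mathlib`, FLOOR-0 P5, pole D9op (`stub_D9op : CorD9OnMOp CMgsm XMgsm`), road 2′ letter **L4** (letters A-p06 (g17) v0.2 754697d1,
census A-p14 (g14) ad4b327d); L5 and the fold into `CorD9OnMOp` are Summits-side.  HC_CM is proved only modulo the 7 printed citations until
rung 0 closes; this file asserts nothing printed — the GEOMETRIC input (the congruence relation on the special fibre, [Liu2021] Prop. D.8 ∕
proof of Cor. D.9) enters as the HYPOTHESIS `hES`.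

## Mathematics

[Liu2021] Cor. D.9 (FJcycle.tex l. 5579–5585; print p. 138 L44 – p. 139 L2): on `H¹_ét(Sh_K ⊗ E^{ac}, ℚ̄_ℓ)`, for almost all split places `w`
with `K` hyperspecial, `X² − t_ϖ^* X + q ⟨ϖ⟩^* = 0` at the geometric Frobenius `X`.  Liu proves it «on `T_K`» (p. 139 L4), i.e. as an
identity of correspondences on the special fibre of the smooth model; read on `H¹ = (V_ℓ Alb)^∨` ([Milne1986AbelianVarieties] Thm. 15.1 (a))
this is an identity `m₁m₂•π² − m₂•θ̄₁π + m₁q•θ̄₂ = 0` in `End(Ā_K)` between the Frobenius endomorphism `π` of the reduction and the reductions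
`θ̄ᵢ` of honest endomorphisms `θᵢ` of `A_K` realising the Hecke operators `T_{w,i}` up to the integers `mᵢ` (★ L0).  This file performs the
purely `ℓ`-adic TRANSPORT of such an identity:
* §1 (`T_ℓ A_K`): [Shimura1998] §19.4 (19.4a) «`𝔐_ℓ(σ) = M_ℓ(φ_𝔭)`» (★ `TateSpecialisation.tateRep_eq_conj_of_isArithFrobAt`) and §11.1 Prop. 14 (i)
  «`M_l(λ) = M_l(λ̃)`» (★ `tateModuleMap_redEnd_eq`) conjugate the identity to `m₁m₂•ρ(σ)² − m₂•T_ℓθ₁ ρ(σ) + m₁q•T_ℓθ₂ = 0` for an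
  arithmetic Frobenius `σ` at the prime `T.prime`; transitivity of `Γ_E` on the primes above `w` (★ `exists_smul_eq_of_mem_primesAbove_holds`,
  [NeukirchANT1999] I (9.1)) and Mathlib `IsArithFrobAt.conj` move it to every prime above `w` (`T_ℓθᵢ` commute with `ρ`);
* §2 (`V_ℓ`, duals): base change `ℤ_ℓ → ℚ_ℓ` and dualisation to `H¹_ét(A_K) = (V_ℓ A_K)^∨` with the contragredient action;
* §3 (tower): the `K`-fixed classes of `ℚ̄_ℓ ⊗ H¹_ét(A_∞)` are level-`K` classes (★ `range_toTower_baseChange_eq_fixedPoints`), `Φ_σ ∘ [·]_K =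
  [·]_K ∘ ρ^∨(σ)` (★ `towerRep_toTower`), and the pins `[ᵗV_ℓ θᵢ ·]_K = mᵢ • [K gᵢ K] [·]_K` (★ L0 shape) give the printed operator identity.

## References
[Liu2021] Y. Liu, *Fourier–Jacobi cycles and arithmetic relative trace formula*, Camb. J. Math. 9 (2021), Cor. D.9, §4.2 ·
[Shimura1998] G. Shimura, *Abelian Varieties with Complex Multiplication and Modular Functions* (1998), §11.1 Prop. 14 (i), §19.4 (19.4a) ·
[NeukirchANT1999] J. Neukirch, *Algebraic Number Theory* (1999), I §9 (9.1) · [Milne1986AbelianVarieties] Thm. 15.1 (a) · [MumfordAV1970] §19 Thm. 3.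
-/

set_option autoImplicit false

noncomputable section

open CategoryTheory IsDedekindDomain NumberField
open scoped NumberField Pointwise TensorProduct

/-! ## §1 The identity on `T_ℓ A₀` at every prime above `v` -/

namespace Literature.AlgebraicGeometry.Motives.AbelianVariety.GoodReductionAt.TateSpecialisation

open Literature.NumberTheory.GaloisRepresentations

variable {K : Type} [Field K] [NumberField K] {A₀ : AbelianVariety K} {v : HeightOneSpectrum (𝓞 K)}
  {R : A₀.GoodReductionAt v} {ℓ : ℕ} [Fact ℓ.Prime]

/-- `T_ℓ f = e⁻¹ ∘ T_ℓ(redEnd f) ∘ e` for the specialisation isomorphism `e : T_ℓ A₀ ≃ T_ℓ Ā` (★ `tateModuleMap_redEnd_eq`, inverted).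
[cite: Shimura1998, §11.1 Prop. 14 (i)] -/
theorem tateModuleMap_eq_symm_comp_redEnd_comp (T : R.TateSpecialisation ℓ) (f : End A₀) :
    tateModuleMap ℓ (End.asHom f) =
      T.equiv.symm.toLinearMap ∘ₗ tateModuleMap ℓ (End.asHom (R.redEnd f)) ∘ₗ T.equiv.toLinearMap := by
  refine LinearMap.ext fun x => ?_
  simp only [LinearMap.coe_comp, Function.comp_apply, LinearEquiv.coe_coe]
  rw [← T.equiv_tateModuleMap, LinearEquiv.symm_apply_apply]

/-- Conjugation by `e⁻¹` carries `T_ℓ(π_Ā)` to `ρ(σ)` for an arithmetic Frobenius `σ` at `T.prime`. [cite: Shimura1998, §19.4 (19.4a)] -/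
theorem conjRingEquiv_symm_tateModuleMap_frobeniusHom (T : R.TateSpecialisation ℓ) {σ : Field.absoluteGaloisGroup K}
    (hσ : IsArithFrobAt (𝓞 K) σ T.prime) :
    T.equiv.symm.conjRingEquiv (tateModuleMap ℓ (End.asHom (End.of (frobeniusHom R.reduction)))) = A₀.tateRep ℓ σ := by
  rw [T.tateRep_eq_conj_of_isArithFrobAt hσ]
  rfl

/-- Conjugation by `e⁻¹` carries `T_ℓ(redEnd f)` to `T_ℓ f`. [cite: Shimura1998, §11.1 Prop. 14 (i)] -/
theorem conjRingEquiv_symm_tateModuleMap_redEnd (T : R.TateSpecialisation ℓ) (f : End A₀) :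
    T.equiv.symm.conjRingEquiv (tateModuleMap ℓ (End.asHom (R.redEnd f))) = tateModuleMap ℓ (End.asHom f) := by
  rw [T.tateModuleMap_eq_symm_comp_redEnd_comp f]
  rfl

omit [NumberField K] in
/-- `T_ℓ` of a two-denominator quadratic expression in `End X` (`T_ℓ : End X → End(T_ℓ X)` is additive and anti-multiplicative, `End.mul_def`;
Mumford §19 Thm. 3). [cite: MumfordAV1970, §19 Thm. 3 (p. 176)] -/
theorem tateModuleMap_quadratic_expr {X : AbelianVariety K} (p t₁ t₂ : End X) (m₁ m₂ q : ℤ) :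
    tateModuleMap ℓ (End.asHom ((m₁ * m₂) • (p * p) - m₂ • (t₁ * p) + (m₁ * q) • t₂)) =
      (m₁ * m₂) • (tateModuleMap ℓ (End.asHom p) * tateModuleMap ℓ (End.asHom p)) -
        m₂ • (tateModuleMap ℓ (End.asHom t₁) * tateModuleMap ℓ (End.asHom p)) +
        (m₁ * q) • tateModuleMap ℓ (End.asHom t₂) := by
  show tateModuleMap ℓ ((m₁ * m₂) • (End.asHom p ≫ End.asHom p) - m₂ • (End.asHom p ≫ End.asHom t₁) +
      (m₁ * q) • End.asHom t₂) = _
  rw [tateModuleMap_add, tateModuleMap_sub, tateModuleMap_zsmul, tateModuleMap_zsmul, tateModuleMap_zsmul,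
    tateModuleMap_comp, tateModuleMap_comp]
  rfl

/-- **Transport to `T_ℓ A₀` at `T.prime`**: an identity `m₁m₂•π² − m₂•θ̄₁π + m₁q•θ̄₂ = 0` in `End(Ā)` (`π` the Frobenius endomorphism,
`θ̄ᵢ = redEnd θᵢ`) gives `m₁m₂•ρ(σ)² − m₂•T_ℓθ₁∘ρ(σ) + m₁q•T_ℓθ₂ = 0` for every arithmetic Frobenius `σ` at `T.prime`.
[cite: Shimura1998, §19.4 (19.4a) and §11.1 Prop. 14 (i)] -/
theorem tateRep_quadratic_of_redEnd (T : R.TateSpecialisation ℓ) {σ : Field.absoluteGaloisGroup K}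
    (hσ : IsArithFrobAt (𝓞 K) σ T.prime) {θ₁ θ₂ : End A₀} {m₁ m₂ q : ℤ}
    (hES : ((m₁ * m₂) • (End.of (frobeniusHom R.reduction) * End.of (frobeniusHom R.reduction))
        - m₂ • (R.redEnd θ₁ * End.of (frobeniusHom R.reduction)) + (m₁ * q) • R.redEnd θ₂ : End R.reduction) = 0) :
    ((m₁ * m₂) • (A₀.tateRep ℓ σ * A₀.tateRep ℓ σ) - m₂ • (tateModuleMap ℓ (End.asHom θ₁) * A₀.tateRep ℓ σ)
        + (m₁ * q) • tateModuleMap ℓ (End.asHom θ₂) : Module.End ℤ_[ℓ] (A₀.tateModule ℓ)) = 0 := by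
  have h : T.equiv.symm.conjRingEquiv (tateModuleMap ℓ (End.asHom
      ((m₁ * m₂) • (End.of (frobeniusHom R.reduction) * End.of (frobeniusHom R.reduction))
        - m₂ • (R.redEnd θ₁ * End.of (frobeniusHom R.reduction)) + (m₁ * q) • R.redEnd θ₂))) =
      T.equiv.symm.conjRingEquiv (tateModuleMap ℓ (End.asHom (0 : End R.reduction))) :=
    congrArg (fun f : End R.reduction => T.equiv.symm.conjRingEquiv (tateModuleMap ℓ (End.asHom f))) hES
  rw [tateModuleMap_quadratic_expr, map_add, map_sub, map_zsmul, map_zsmul, map_zsmul, map_mul, map_mul,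
    T.conjRingEquiv_symm_tateModuleMap_frobeniusHom hσ, T.conjRingEquiv_symm_tateModuleMap_redEnd,
    T.conjRingEquiv_symm_tateModuleMap_redEnd] at h
  rw [h]
  show T.equiv.symm.conjRingEquiv (tateModuleMap ℓ (0 : R.reduction ⟶ R.reduction)) = 0
  rw [tateModuleMap_zero, map_zero]

set_option synthInstance.maxHeartbeats 80000 in
-- the pointwise `MulAction Γ_K (Ideal ℤ̄_K)` behind `τ • 𝔓` is slow to synthesise in this import closure
/-- A Frobenius at any prime above `v` is `Γ_K`-conjugate to a Frobenius at `T.prime` (transitivity of `Γ_K` on the primes above `v`).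
[cite: NeukirchANT1999, Ch. I §9 Prop. (9.1)] -/
theorem exists_conj_isArithFrobAt_prime (T : R.TateSpecialisation ℓ) {𝔓 : Ideal (absIntegers (𝓞 K) K)}
    (h𝔓 : 𝔓 ∈ v.primesAbove) {σ : Field.absoluteGaloisGroup K} (hσ : IsArithFrobAt (𝓞 K) σ 𝔓) :
    ∃ τ : Field.absoluteGaloisGroup K, IsArithFrobAt (𝓞 K) (τ⁻¹ * σ * τ) T.prime := by
  obtain ⟨τ, hτ⟩ := HeightOneSpectrum.exists_smul_eq_of_mem_primesAbove_holds T.prime_mem h𝔓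
  refine ⟨τ, ?_⟩
  have h := hσ.conj τ⁻¹
  rw [inv_inv, ← hτ, inv_smul_smul] at h
  exact h

/-- **Transport to `T_ℓ A₀` at EVERY prime above `v`**: the identity of `tateRep_quadratic_of_redEnd` holds for every arithmetic Frobenius
at every `𝔓 ∣ v` (conjugate by `ρ(τ)`, which commutes with `T_ℓθᵢ`). [cite: Shimura1998, §19.4 (19.4a) and Lemma 19.5] [cite: NeukirchANT1999, Ch. I §9 Prop. (9.1)] -/
theorem tateRep_quadratic_of_redEnd_of_mem_primesAbove (T : R.TateSpecialisation ℓ) {𝔓 : Ideal (absIntegers (𝓞 K) K)}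
    (h𝔓 : 𝔓 ∈ v.primesAbove) {σ : Field.absoluteGaloisGroup K} (hσ : IsArithFrobAt (𝓞 K) σ 𝔓)
    {θ₁ θ₂ : End A₀} {m₁ m₂ q : ℤ}
    (hES : ((m₁ * m₂) • (End.of (frobeniusHom R.reduction) * End.of (frobeniusHom R.reduction))
        - m₂ • (R.redEnd θ₁ * End.of (frobeniusHom R.reduction)) + (m₁ * q) • R.redEnd θ₂ : End R.reduction) = 0) :
    ((m₁ * m₂) • (A₀.tateRep ℓ σ * A₀.tateRep ℓ σ) - m₂ • (tateModuleMap ℓ (End.asHom θ₁) * A₀.tateRep ℓ σ)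
        + (m₁ * q) • tateModuleMap ℓ (End.asHom θ₂) : Module.End ℤ_[ℓ] (A₀.tateModule ℓ)) = 0 := by
  obtain ⟨τ, hτ⟩ := T.exists_conj_isArithFrobAt_prime h𝔓 hσ
  have h := T.tateRep_quadratic_of_redEnd hτ hES
  have hρ : A₀.tateRep ℓ σ = A₀.tateRep ℓ τ * A₀.tateRep ℓ (τ⁻¹ * σ * τ) * A₀.tateRep ℓ τ⁻¹ := by
    rw [← map_mul, ← map_mul]; congr 1; group
  have hc : ∀ θ : End A₀, tateModuleMap ℓ (End.asHom θ) * A₀.tateRep ℓ τ = A₀.tateRep ℓ τ * tateModuleMap ℓ (End.asHom θ) :=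
    fun θ => LinearMap.ext fun x => by
      simp only [Module.End.mul_apply, AbelianVariety.tateRep_apply_apply]
      exact tateModuleMap_smul (End.asHom θ) τ x
  have hinv : A₀.tateRep ℓ τ⁻¹ * A₀.tateRep ℓ τ = 1 := by rw [← map_mul, inv_mul_cancel, map_one]
  have hinv' : A₀.tateRep ℓ τ * A₀.tateRep ℓ τ⁻¹ = 1 := by rw [← map_mul, mul_inv_cancel, map_one]
  have h2 := congrArg (fun X : Module.End ℤ_[ℓ] (A₀.tateModule ℓ) => A₀.tateRep ℓ τ * X * A₀.tateRep ℓ τ⁻¹) h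
  simp only [mul_zero, zero_mul] at h2
  rw [← h2, hρ]
  set a := A₀.tateRep ℓ τ
  set b := A₀.tateRep ℓ (τ⁻¹ * σ * τ)
  set c := A₀.tateRep ℓ τ⁻¹
  set t₁ := tateModuleMap ℓ (End.asHom θ₁)
  set t₂ := tateModuleMap ℓ (End.asHom θ₂)
  have e1 : a * b * c * (a * b * c) = a * (b * b) * c := by
    calc a * b * c * (a * b * c) = a * b * (c * a) * b * c := by noncomm_ring
      _ = a * (b * b) * c := by rw [hinv]; noncomm_ring
  have e2 : t₁ * (a * b * c) = a * (t₁ * b) * c := by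
    calc t₁ * (a * b * c) = (t₁ * a) * b * c := by noncomm_ring
      _ = a * (t₁ * b) * c := by rw [hc θ₁]; noncomm_ring
  have e3 : t₂ = a * t₂ * c := by
    calc t₂ = t₂ * (a * c) := by rw [hinv', mul_one]
      _ = (t₂ * a) * c := by noncomm_ring
      _ = a * t₂ * c := by rw [hc θ₂]
  rw [e1, e2]
  conv_lhs => rw [e3]
  simp only [mul_sub, sub_mul, mul_add, add_mul, mul_smul_comm, smul_mul_assoc]

end Literature.AlgebraicGeometry.Motives.AbelianVariety.GoodReductionAt.TateSpecialisation

/-! ## §2 Base change to `V_ℓ`, dualisation, and the receptacle algebra (generic) -/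

namespace Literature.NumberTheory.Automorphic.Liu2021.AppendixC

/-- **Dualising a quadratic Frobenius identity** (generic; no commutation needed): if `a•ρ(σ)² − b•(t₁ ∘ ρσ) + c•t₂ = 0` on `V`, then on
`Module.Dual k V` with the contragredient action `ρ^∨(σ) = ᵗρ(σ⁻¹)`: `c•(ρ^∨σ ∘ ρ^∨σ ∘ ᵗt₂) − b•(ρ^∨σ ∘ ᵗt₁) + a•1 = 0` — the linear algebra of
[Liu2021]'s «By comparison, it suffices to prove this identity on `T_K`» (proof of Cor. D.9, p. 139 L3–L8: the identity for the geometric Frobenius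
`X = (σ⁻¹)^*` on `H¹ = (V_ℓ)^∨` versus the identity for `π` on `V_ℓ`). [cite: Liu2021, Cor. D.9, proof (FJcycle.tex l. 5586–5600)] -/
theorem dual_quadratic_identity {k V G : Type*} [CommRing k] [AddCommGroup V] [Module k V] [Group G]
    (ρ : Representation k G V) (t₁ t₂ : Module.End k V) (a b c : k) (σ : G)
    (h : a • (ρ σ * ρ σ) - b • (t₁ * ρ σ) + c • t₂ = 0) :
    c • (ρ.dual σ * ρ.dual σ * t₂.dualMap) - b • (ρ.dual σ * t₁.dualMap) + a • (1 : Module.End k (Module.Dual k V)) = 0 := by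
  have hρ : ∀ v, ρ σ (ρ σ⁻¹ v) = v := fun v => by
    rw [← Module.End.mul_apply, ← map_mul, mul_inv_cancel, map_one, Module.End.one_apply]
  refine LinearMap.ext fun φ => LinearMap.ext fun v => ?_
  have hv := congrArg φ (LinearMap.congr_fun h (ρ σ⁻¹ (ρ σ⁻¹ v)))
  simp only [LinearMap.add_apply, LinearMap.sub_apply, LinearMap.smul_apply, Module.End.mul_apply, hρ,
    LinearMap.zero_apply, map_zero, map_add, map_sub, map_smul, smul_eq_mul] at hv
  simp only [LinearMap.add_apply, LinearMap.sub_apply, LinearMap.smul_apply, Module.End.mul_apply,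
    Module.End.one_apply, LinearMap.zero_apply, Representation.dual_apply, Module.Dual.transpose_apply,
    LinearMap.dualMap_apply, LinearMap.comp_apply, smul_eq_mul]
  linear_combination hv

/-- **The receptacle** (generic assembly over `k`, read in `R ⊗_k −`).  Let `ι : D → W`, `Φ ∈ End W`, `r ∈ End D` with `Φ ∘ ι = ι ∘ r`,
operators `T₁, T₂ ∈ End W` pinned to `Θ₁, Θ₂ ∈ End D` by `ι ∘ Θᵢ = mᵢ • Tᵢ ∘ ι`, and `(m₁q)•r r Θ₂ − m₂•r Θ₁ + (m₁m₂)•1 = 0` on `D` with `m₁m₂`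
a unit of `k`.  Then `y := (1 ⊗ ι) x` satisfies `q • Φ(Φ(T₂ y)) − Φ(T₁ y) + y = 0` in `R ⊗ W` for every `x ∈ R ⊗ D` — the linear algebra of
reading [Liu2021, Cor. D.9] on `ℚ̄_ℓ ⊗ colim_K H¹_ét(A_K)` from its level-`K` form (§4.2 l. 2152–2160: `H¹_ét(A_∞) := colim_K`, `⊗ ℚ_ℓ^{ac}`).
[cite: Liu2021, Cor. D.9 with §4.2 (FJcycle.tex l. 5579–5585, 2152–2160)] -/
theorem receptacle_quadratic_identity {k R D W : Type*} [CommRing k] [CommRing R] [Algebra k R]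
    [AddCommGroup D] [Module k D] [AddCommGroup W] [Module k W]
    (ι : D →ₗ[k] W) (Φ : W →ₗ[k] W) (r : D →ₗ[k] D) (T₁ T₂ : W →ₗ[k] W) (Θ₁ Θ₂ : D →ₗ[k] D) (m₁ m₂ : ℤ) (q : ℕ)
    (hΦ : Φ ∘ₗ ι = ι ∘ₗ r)
    (h₁ : ι ∘ₗ Θ₁ = (m₁ : k) • (T₁ ∘ₗ ι)) (h₂ : ι ∘ₗ Θ₂ = (m₂ : k) • (T₂ ∘ₗ ι))
    (hE : ((m₁ * q : ℤ) : k) • (r * r * Θ₂) - ((m₂ : ℤ) : k) • (r * Θ₁) + ((m₁ * m₂ : ℤ) : k) • (1 : Module.End k D) = 0)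
    (hu : IsUnit ((m₁ * m₂ : ℤ) : k)) (x : R ⊗[k] D) :
    (q : R) • Φ.baseChange R (Φ.baseChange R ((T₂.baseChange R) (ι.baseChange R x))) -
        Φ.baseChange R ((T₁.baseChange R) (ι.baseChange R x)) + ι.baseChange R x = 0 := by
  have cΦ : ∀ z : R ⊗[k] D, Φ.baseChange R (ι.baseChange R z) = ι.baseChange R (r.baseChange R z) := fun z => by
    rw [← LinearMap.comp_apply, ← LinearMap.baseChange_comp, hΦ, LinearMap.baseChange_comp, LinearMap.comp_apply]
  have p₁ : (m₁ : k) • T₁.baseChange R (ι.baseChange R x) = ι.baseChange R (Θ₁.baseChange R x) := by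
    have := congrArg (fun L : D →ₗ[k] W => L.baseChange R x) h₁
    simpa only [LinearMap.baseChange_comp, LinearMap.baseChange_smul, LinearMap.comp_apply, LinearMap.smul_apply] using this.symm
  have p₂ : (m₂ : k) • T₂.baseChange R (ι.baseChange R x) = ι.baseChange R (Θ₂.baseChange R x) := by
    have := congrArg (fun L : D →ₗ[k] W => L.baseChange R x) h₂
    simpa only [LinearMap.baseChange_comp, LinearMap.baseChange_smul, LinearMap.comp_apply, LinearMap.smul_apply] using this.symm
  have e : ((m₁ * q : ℤ) : k) • r.baseChange R (r.baseChange R (Θ₂.baseChange R x)) -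
      ((m₂ : ℤ) : k) • r.baseChange R (Θ₁.baseChange R x) + ((m₁ * m₂ : ℤ) : k) • x = 0 := by
    have := congrArg (fun L : Module.End k D => L.baseChange R x) hE
    simpa only [LinearMap.baseChange_add, LinearMap.baseChange_sub, LinearMap.baseChange_smul, LinearMap.baseChange_mul,
      LinearMap.baseChange_one, LinearMap.add_apply, LinearMap.sub_apply, LinearMap.smul_apply, Module.End.mul_apply,
      Module.End.one_apply, LinearMap.baseChange_zero, LinearMap.zero_apply] using this
  rw [Nat.cast_smul_eq_nsmul R, ← Nat.cast_smul_eq_nsmul k]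
  refine (hu.smul_eq_zero).mp ?_
  have key : ((m₁ * m₂ : ℤ) : k) • ((q : k) • Φ.baseChange R (Φ.baseChange R ((T₂.baseChange R) (ι.baseChange R x))) -
        Φ.baseChange R ((T₁.baseChange R) (ι.baseChange R x)) + ι.baseChange R x) =
      ι.baseChange R (((m₁ * q : ℤ) : k) • r.baseChange R (r.baseChange R (Θ₂.baseChange R x)) -
        ((m₂ : ℤ) : k) • r.baseChange R (Θ₁.baseChange R x) + ((m₁ * m₂ : ℤ) : k) • x) := by
    rw [map_add, map_sub, LinearMap.map_smul_of_tower, LinearMap.map_smul_of_tower, ← cΦ, ← cΦ, ← cΦ, ← p₁, ← p₂,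
      LinearMap.map_smul_of_tower, LinearMap.map_smul_of_tower, LinearMap.map_smul_of_tower, LinearMap.map_smul_of_tower]
    simp only [smul_sub, smul_add, smul_smul, Int.cast_mul, Int.cast_natCast]
    module
  rw [key, e, map_zero]

end Literature.NumberTheory.Automorphic.Liu2021.AppendixC

namespace Literature.AlgebraicGeometry.Motives.AbelianVariety

open Literature.NumberTheory.Automorphic.Liu2021.AppendixC (dual_quadratic_identity)

variable {K : Type} [Field K] {A₀ : AbelianVariety K} {ℓ : ℕ} [Fact ℓ.Prime]

/-- **Base change to `V_ℓ = ℚ_ℓ ⊗ T_ℓ`** of the quadratic identity (★ `rationalTateRep_apply` is `rfl`; Mathlib `Module.End.baseChangeHom`).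
[cite: Shimura1998, §19.4 (19.4a)] -/
theorem rationalTateRep_quadratic_of_tateRep (σ : Field.absoluteGaloisGroup K) {θ₁ θ₂ : End A₀} {m₁ m₂ q : ℤ}
    (h : ((m₁ * m₂) • (A₀.tateRep ℓ σ * A₀.tateRep ℓ σ) - m₂ • (tateModuleMap ℓ (End.asHom θ₁) * A₀.tateRep ℓ σ)
        + (m₁ * q) • tateModuleMap ℓ (End.asHom θ₂) : Module.End ℤ_[ℓ] (A₀.tateModule ℓ)) = 0) :
    ((m₁ * m₂) • (A₀.rationalTateRep ℓ σ * A₀.rationalTateRep ℓ σ)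
        - m₂ • (rationalTateModuleMap ℓ (End.asHom θ₁) * A₀.rationalTateRep ℓ σ)
        + (m₁ * q) • rationalTateModuleMap ℓ (End.asHom θ₂) : Module.End ℚ_[ℓ] (A₀.rationalTateModule ℓ)) = 0 := by
  have h2 := congrArg (Module.End.baseChangeHom ℤ_[ℓ] ℚ_[ℓ] (A₀.tateModule ℓ)) h
  rw [map_zero, map_add, map_sub, map_zsmul, map_zsmul, map_zsmul, map_mul, map_mul] at h2
  rw [rationalTateRep_apply]
  exact h2

/-- **Dual form on `(V_ℓ A₀)^∨`** with `ℚ_ℓ`-scalars and the contragredient action. [cite: Milne1986AbelianVarieties, Thm. 15.1 (a)] -/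
theorem dual_rationalTateRep_quadratic_of_tateRep (σ : Field.absoluteGaloisGroup K) {θ₁ θ₂ : End A₀} {m₁ m₂ q : ℤ}
    (h : ((m₁ * m₂) • (A₀.tateRep ℓ σ * A₀.tateRep ℓ σ) - m₂ • (tateModuleMap ℓ (End.asHom θ₁) * A₀.tateRep ℓ σ)
        + (m₁ * q) • tateModuleMap ℓ (End.asHom θ₂) : Module.End ℤ_[ℓ] (A₀.tateModule ℓ)) = 0) :
    ((m₁ * q : ℤ) : ℚ_[ℓ]) • ((A₀.rationalTateRep ℓ).dual σ * (A₀.rationalTateRep ℓ).dual σ *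
          (rationalTateModuleMap ℓ (End.asHom θ₂)).dualMap)
      - ((m₂ : ℤ) : ℚ_[ℓ]) • ((A₀.rationalTateRep ℓ).dual σ * (rationalTateModuleMap ℓ (End.asHom θ₁)).dualMap)
      + ((m₁ * m₂ : ℤ) : ℚ_[ℓ]) • (1 : Module.End ℚ_[ℓ] (Module.Dual ℚ_[ℓ] (A₀.rationalTateModule ℓ))) = 0 := by
  have h2 := rationalTateRep_quadratic_of_tateRep σ h
  rw [← Int.cast_smul_eq_zsmul ℚ_[ℓ], ← Int.cast_smul_eq_zsmul ℚ_[ℓ] m₂, ← Int.cast_smul_eq_zsmul ℚ_[ℓ] (m₁ * q)] at h2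
  exact dual_quadratic_identity (A₀.rationalTateRep ℓ) _ _ _ _ _ σ h2

end Literature.AlgebraicGeometry.Motives.AbelianVariety

/-! ## §3 On the Albanese tower `H¹_ét(A_∞)` of a §4.2 datum: level classes, pins, and the operator identity -/

namespace Literature.NumberTheory.Automorphic.Liu2021.AppendixC

open Literature.AlgebraicGeometry.Motives Literature.AlgebraicGeometry.Motives.AbelianVariety
open Literature.NumberTheory.Automorphic Literature.RepresentationTheory.IntertwiningBaseChange
open Literature.NumberTheory.GaloisRepresentations

variable {F E : Type} [Field F] [NumberField F] [IsTotallyReal F] [Field E] [NumberField E] [Algebra F E]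
  [IsTotallyComplex E] [Algebra.IsQuadraticExtension F E]
variable {P5 : PropC5Data F E} {isotropicAt : ℕ → Prop}

namespace Sec42Data

variable (C : Sec42Data P5 isotropicAt) (ℓ : ℕ) [Fact ℓ.Prime]

/-- The quadratic identity on `H¹_ét(A_K) = (V_ℓ A_K)^∨` with `etaleH1Rep = (rationalTateRep)^∨`, from the `T_ℓ` form.
[cite: Liu2021, §4.2 (FJcycle.tex l. 2160)] [cite: Milne1986AbelianVarieties, Thm. 15.1 (a)] -/
theorem etaleH1Rep_quadratic_of_tateRep (K : C5.SmallLevel C.S.K₀) (σ : Field.absoluteGaloisGroup E)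
    {θ₁ θ₂ : End (C.A K)} {m₁ m₂ q : ℤ}
    (h : ((m₁ * m₂) • ((C.A K).tateRep ℓ σ * (C.A K).tateRep ℓ σ) - m₂ • (tateModuleMap ℓ (End.asHom θ₁) * (C.A K).tateRep ℓ σ)
        + (m₁ * q) • tateModuleMap ℓ (End.asHom θ₂) : Module.End ℤ_[ℓ] ((C.A K).tateModule ℓ)) = 0) :
    ((m₁ * q : ℤ) : ℚ_[ℓ]) • (C.etaleH1Rep ℓ K σ * C.etaleH1Rep ℓ K σ * (rationalTateModuleMap ℓ (End.asHom θ₂)).dualMap)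
      - ((m₂ : ℤ) : ℚ_[ℓ]) • (C.etaleH1Rep ℓ K σ * (rationalTateModuleMap ℓ (End.asHom θ₁)).dualMap)
      + ((m₁ * m₂ : ℤ) : ℚ_[ℓ]) • (1 : Module.End ℚ_[ℓ] (C.etaleH1 ℓ K)) = 0 :=
  dual_rationalTateRep_quadratic_of_tateRep σ h

/-- `Φ_σ ∘ [·]_K = [·]_K ∘ ρ^∨(σ)` as linear maps (★ `towerRep_toTower`). [cite: Liu2021, §4.2 (FJcycle.tex l. 2158–2160)] -/
theorem towerRep_comp_toTower (K : C5.SmallLevel C.S.K₀) (σ : Field.absoluteGaloisGroup E) :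
    (C.towerRep ℓ σ : C.etaleH1Tower ℓ →ₗ[ℚ_[ℓ]] C.etaleH1Tower ℓ) ∘ₗ C.toTower ℓ K = C.toTower ℓ K ∘ₗ C.etaleH1Rep ℓ K σ :=
  LinearMap.ext fun φ => C.towerRep_toTower ℓ K σ φ

end Sec42Data

namespace Sec42Data.HeckeTranslates

variable {C : Sec42Data P5 isotropicAt} (T : C.HeckeTranslates) (ℓ : ℕ) [Fact ℓ.Prime]

/-- **A `K`-fixed class of `ℚ̄_ℓ ⊗ H¹_ét(A_∞)` is a level-`K` class** (★ `range_toTower_baseChange_eq_fixedPoints` at the base-changed Hecke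
action `repBaseChange ℚ̄_ℓ etHeckeRep`). [cite: Liu2021, Thm. 4.18 (1) (FJcycle.tex l. 2239)] -/
theorem exists_toTower_baseChange_eq_of_forall
    (hI : ∀ ⦃K K' : C5.SmallLevel C.S.K₀⦄ (f : K' ⟶ K), Function.Injective (rationalTateModuleMap ℓ (C.Atr f)).dualMap)
    (hD : T.IsogenyDescent) (K : C5.SmallLevel C.S.K₀) {y : AlgebraicClosure ℚ_[ℓ] ⊗[ℚ_[ℓ]] C.etaleH1Tower ℓ}
    (hy : ∀ k ∈ K.1.1, (T.etHeckeRep ℓ k).baseChange (AlgebraicClosure ℚ_[ℓ]) y = y) :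
    ∃ x : AlgebraicClosure ℚ_[ℓ] ⊗[ℚ_[ℓ]] C.etaleH1 ℓ K, (C.toTower ℓ K).baseChange (AlgebraicClosure ℚ_[ℓ]) x = y := by
  have hmem : y ∈ (repBaseChange (AlgebraicClosure ℚ_[ℓ]) (T.etHeckeRep ℓ)).fixedPoints (K.1.1 : Subgroup C.G) := by
    rw [Representation.mem_fixedPoints]
    intro k hk
    rw [repBaseChange_apply]
    exact hy k hk
  rw [← T.range_toTower_baseChange_eq_fixedPoints ℓ K hI (repBaseChange (AlgebraicClosure ℚ_[ℓ]) (T.etHeckeRep ℓ))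
    (fun g => repBaseChange_apply _ _ g) hD] at hmem
  exact hmem

/-- A pinned pair `(ψ, m)` for `[KgK]` at level `K` (the ★ L0 shape `exists_hom_toTower_dualMap_eq_smul_heckeOperator`), as a linear-map
identity. [cite: Liu2021, §4.2 (FJcycle.tex l. 2074)] -/
theorem toTower_comp_dualMap_eq_smul_of_pin (K : C5.SmallLevel C.S.K₀) (g : C.G) {m : ℤ} {ψ : C.A K ⟶ C.A K}
    (h : ∀ φ : C.etaleH1 ℓ K, C.toTower ℓ K ((rationalTateModuleMap ℓ ψ).dualMap φ) =
      (m : ℚ_[ℓ]) • heckeOperator (T.etHeckeRep ℓ) (K.1.1 : Subgroup C.G) g (C.toTower ℓ K φ)) :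
    C.toTower ℓ K ∘ₗ (rationalTateModuleMap ℓ ψ).dualMap =
      (m : ℚ_[ℓ]) • (heckeOperator (T.etHeckeRep ℓ) (K.1.1 : Subgroup C.G) g ∘ₗ C.toTower ℓ K) :=
  LinearMap.ext fun φ => by simpa only [LinearMap.coe_comp, Function.comp_apply, LinearMap.smul_apply] using h φ

/-- **The operator identity on the tower from the level-`K` dual identity**: for a `K`-fixed class `y`, pins `(θᵢ, mᵢ)` of `[K gᵢ K]`
(`mᵢ ≠ 0`) and `(m₁q)•r r ᵗVθ₂ − m₂•r ᵗVθ₁ + (m₁m₂)•1 = 0` on `H¹_ét(A_K)` (`r = etaleH1Rep K σ`):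
`q • Φ_σ(Φ_σ([Kg₂K] y)) − Φ_σ([Kg₁K] y) + y = 0` on `ℚ̄_ℓ ⊗ H¹_ét(A_∞)`. [cite: Liu2021, Cor. D.9 (FJcycle.tex l. 5579–5585)] -/
theorem towerRep_quadratic_of_etaleH1Rep
    (hI : ∀ ⦃K K' : C5.SmallLevel C.S.K₀⦄ (f : K' ⟶ K), Function.Injective (rationalTateModuleMap ℓ (C.Atr f)).dualMap)
    (hD : T.IsogenyDescent) (K : C5.SmallLevel C.S.K₀) (σ : Field.absoluteGaloisGroup E) (g₁ g₂ : C.G)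
    {θ₁ θ₂ : End (C.A K)} {m₁ m₂ : ℤ} (q : ℕ) (hm₁ : m₁ ≠ 0) (hm₂ : m₂ ≠ 0)
    (hθ₁ : ∀ φ : C.etaleH1 ℓ K, C.toTower ℓ K ((rationalTateModuleMap ℓ (End.asHom θ₁)).dualMap φ) =
      (m₁ : ℚ_[ℓ]) • heckeOperator (T.etHeckeRep ℓ) (K.1.1 : Subgroup C.G) g₁ (C.toTower ℓ K φ))
    (hθ₂ : ∀ φ : C.etaleH1 ℓ K, C.toTower ℓ K ((rationalTateModuleMap ℓ (End.asHom θ₂)).dualMap φ) =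
      (m₂ : ℚ_[ℓ]) • heckeOperator (T.etHeckeRep ℓ) (K.1.1 : Subgroup C.G) g₂ (C.toTower ℓ K φ))
    (hE : ((m₁ * q : ℤ) : ℚ_[ℓ]) • (C.etaleH1Rep ℓ K σ * C.etaleH1Rep ℓ K σ * (rationalTateModuleMap ℓ (End.asHom θ₂)).dualMap)
      - ((m₂ : ℤ) : ℚ_[ℓ]) • (C.etaleH1Rep ℓ K σ * (rationalTateModuleMap ℓ (End.asHom θ₁)).dualMap)
      + ((m₁ * m₂ : ℤ) : ℚ_[ℓ]) • (1 : Module.End ℚ_[ℓ] (C.etaleH1 ℓ K)) = 0)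
    {y : AlgebraicClosure ℚ_[ℓ] ⊗[ℚ_[ℓ]] C.etaleH1Tower ℓ}
    (hy : ∀ k ∈ K.1.1, (T.etHeckeRep ℓ k).baseChange (AlgebraicClosure ℚ_[ℓ]) y = y) :
    (q : AlgebraicClosure ℚ_[ℓ]) •
        ((C.towerRep ℓ σ : C.etaleH1Tower ℓ →ₗ[ℚ_[ℓ]] C.etaleH1Tower ℓ).baseChange (AlgebraicClosure ℚ_[ℓ]))
          (((C.towerRep ℓ σ : C.etaleH1Tower ℓ →ₗ[ℚ_[ℓ]] C.etaleH1Tower ℓ).baseChange (AlgebraicClosure ℚ_[ℓ]))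
            ((heckeOperator (T.etHeckeRep ℓ) (K.1.1 : Subgroup C.G) g₂).baseChange (AlgebraicClosure ℚ_[ℓ]) y)) -
      ((C.towerRep ℓ σ : C.etaleH1Tower ℓ →ₗ[ℚ_[ℓ]] C.etaleH1Tower ℓ).baseChange (AlgebraicClosure ℚ_[ℓ]))
          ((heckeOperator (T.etHeckeRep ℓ) (K.1.1 : Subgroup C.G) g₁).baseChange (AlgebraicClosure ℚ_[ℓ]) y) + y = 0 := by
  obtain ⟨x, rfl⟩ := T.exists_toTower_baseChange_eq_of_forall ℓ hI hD K hy
  have hu : IsUnit ((m₁ * m₂ : ℤ) : ℚ_[ℓ]) := by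
    rw [isUnit_iff_ne_zero, Int.cast_ne_zero]
    exact mul_ne_zero hm₁ hm₂
  exact receptacle_quadratic_identity (C.toTower ℓ K)
    (C.towerRep ℓ σ : C.etaleH1Tower ℓ →ₗ[ℚ_[ℓ]] C.etaleH1Tower ℓ) (C.etaleH1Rep ℓ K σ)
    (heckeOperator (T.etHeckeRep ℓ) (K.1.1 : Subgroup C.G) g₁) (heckeOperator (T.etHeckeRep ℓ) (K.1.1 : Subgroup C.G) g₂)
    (rationalTateModuleMap ℓ (End.asHom θ₁)).dualMap (rationalTateModuleMap ℓ (End.asHom θ₂)).dualMap m₁ m₂ q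
    (C.towerRep_comp_toTower ℓ K σ)
    (T.toTower_comp_dualMap_eq_smul_of_pin ℓ K g₁ hθ₁) (T.toTower_comp_dualMap_eq_smul_of_pin ℓ K g₂ hθ₂) hE hu x

/-- **Letter L4 of road 2′ — [Liu2021, Cor. D.9] operator identity at level `K` FROM an Eichler–Shimura identity in `End(Ā_K)`.**
For a §4.2 datum `C` with translates `T` (injective étale pull-backs `hI`, descent up to isogeny `hD`), a small level `K`, a place `w` of `E`
with a good-reduction datum `R` of `A_K` and an `ℓ`-adic specialisation datum `S`, pinned pairs `(θᵢ, mᵢ ≠ 0)` realising `[K gᵢ K]` on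
`H¹_ét(A_K)` (★ `exists_hom_toTower_dualMap_eq_smul_heckeOperator`), and the identity
`m₁m₂•π² − m₂•θ̄₁π + m₁q•θ̄₂ = 0` in `End(Ā_K)` (`π` = Frobenius of the reduction, `θ̄ᵢ = redEnd θᵢ`): for every prime `𝔓 ∣ w`, every
arithmetic Frobenius `σ` at `𝔓` and every `K`-fixed `y ∈ ℚ̄_ℓ ⊗ H¹_ét(A_∞)`, `q • Φ_σ(Φ_σ([Kg₂K] y)) − Φ_σ([Kg₁K] y) + y = 0`.
[cite: Liu2021, Cor. D.9 (FJcycle.tex l. 5579–5585)] [cite: Shimura1998, §19.4 (19.4a) and §11.1 Prop. 14 (i)] -/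
theorem towerRep_quadratic_of_redEnd
    (hI : ∀ ⦃K K' : C5.SmallLevel C.S.K₀⦄ (f : K' ⟶ K), Function.Injective (rationalTateModuleMap ℓ (C.Atr f)).dualMap)
    (hD : T.IsogenyDescent) (K : C5.SmallLevel C.S.K₀) {w : HeightOneSpectrum (𝓞 E)} {R : (C.A K).GoodReductionAt w}
    (S : R.TateSpecialisation ℓ) (g₁ g₂ : C.G) {θ₁ θ₂ : End (C.A K)} {m₁ m₂ : ℤ} (q : ℕ) (hm₁ : m₁ ≠ 0) (hm₂ : m₂ ≠ 0)
    (hθ₁ : ∀ φ : C.etaleH1 ℓ K, C.toTower ℓ K ((rationalTateModuleMap ℓ (End.asHom θ₁)).dualMap φ) =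
      (m₁ : ℚ_[ℓ]) • heckeOperator (T.etHeckeRep ℓ) (K.1.1 : Subgroup C.G) g₁ (C.toTower ℓ K φ))
    (hθ₂ : ∀ φ : C.etaleH1 ℓ K, C.toTower ℓ K ((rationalTateModuleMap ℓ (End.asHom θ₂)).dualMap φ) =
      (m₂ : ℚ_[ℓ]) • heckeOperator (T.etHeckeRep ℓ) (K.1.1 : Subgroup C.G) g₂ (C.toTower ℓ K φ))
    (hES : ((m₁ * m₂) • (End.of (frobeniusHom R.reduction) * End.of (frobeniusHom R.reduction))
        - m₂ • (R.redEnd θ₁ * End.of (frobeniusHom R.reduction)) + (m₁ * (q : ℤ)) • R.redEnd θ₂ : End R.reduction) = 0)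
    {𝔓 : Ideal (absIntegers (𝓞 E) E)} (h𝔓 : 𝔓 ∈ w.primesAbove) {σ : Field.absoluteGaloisGroup E} (hσ : IsArithFrobAt (𝓞 E) σ 𝔓)
    {y : AlgebraicClosure ℚ_[ℓ] ⊗[ℚ_[ℓ]] C.etaleH1Tower ℓ}
    (hy : ∀ k ∈ K.1.1, (T.etHeckeRep ℓ k).baseChange (AlgebraicClosure ℚ_[ℓ]) y = y) :
    (q : AlgebraicClosure ℚ_[ℓ]) •
        ((C.towerRep ℓ σ : C.etaleH1Tower ℓ →ₗ[ℚ_[ℓ]] C.etaleH1Tower ℓ).baseChange (AlgebraicClosure ℚ_[ℓ]))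
          (((C.towerRep ℓ σ : C.etaleH1Tower ℓ →ₗ[ℚ_[ℓ]] C.etaleH1Tower ℓ).baseChange (AlgebraicClosure ℚ_[ℓ]))
            ((heckeOperator (T.etHeckeRep ℓ) (K.1.1 : Subgroup C.G) g₂).baseChange (AlgebraicClosure ℚ_[ℓ]) y)) -
      ((C.towerRep ℓ σ : C.etaleH1Tower ℓ →ₗ[ℚ_[ℓ]] C.etaleH1Tower ℓ).baseChange (AlgebraicClosure ℚ_[ℓ]))
          ((heckeOperator (T.etHeckeRep ℓ) (K.1.1 : Subgroup C.G) g₁).baseChange (AlgebraicClosure ℚ_[ℓ]) y) + y = 0 :=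
  T.towerRep_quadratic_of_etaleH1Rep ℓ hI hD K σ g₁ g₂ q hm₁ hm₂ hθ₁ hθ₂
    (C.etaleH1Rep_quadratic_of_tateRep ℓ K σ (S.tateRep_quadratic_of_redEnd_of_mem_primesAbove h𝔓 hσ hES)) hy

end Sec42Data.HeckeTranslates

end Literature.NumberTheory.Automorphic.Liu2021.AppendixC

end
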